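import Literature.NumberTheory.LFunctions.ZetaZeroGapsRHGoldstonGonek
import Literature.NumberTheory.LFunctions.ZetaZerosShortIntervalsRHLong
import Literature.NumberTheory.LFunctions.ZetaZerosShortIntervalsGG
import HarnessLib

/-!
# RH-CONDITIONAL — Goldston–Gonek 2007, Theorem 1: DISCHARGE of `GoldstonGonek2007_thm1` («nothing here bears on the truth of RH»)

Topic `Literature/NumberTheory/LFunctions`. Everything in this file is PROVED (no definitions, no
named facts). Label: **RH-CONDITIONAL** — RH is the ANTECEDENT of the theorem; nothing is asserted
about RH and nothing here bears on the truth of RH.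

Discharge of the named fact `Literature.NumberTheory.LFunctions.GoldstonGonek2007_thm1`
(`ZetaZeroGapsRHGoldstonGonek.lean`): D. A. Goldston, S. M. Gonek, *A note on `S(t)` and the
zeros of the Riemann zeta-function*, Bull. Lond. Math. Soc. **39** (2007) 482–486, **Theorem 1**:

> Assume the Riemann Hypothesis. Let `t` be large and `0 < h ≤ √t`. Then
> `|N(t+h) − N(t) − (h/2π) log(t/2π)| ≤ (½ + o(1)) log t/log log t`.

Proof, as printed (GG2007 §2 = Balazard–de Roton, arXiv:0810.3587, Props. 15–16): the two-sided
Prop. 15 on the full range `0 < h ≤ √t` (`ZetaZerosShortIntervalsRHLong.lean`: Selberg's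
functions `F±` of `[−h', h']`, the Guinand–Weil explicit formula under RH, and the archimedean
integral `(2h' ± 1/Δ) log(t/2) + O(1)` of `SelbergArchimedeanIntegralLong.lean`), applied at the
centre `τ = t + h/2` with half-width `h' = h/2` (so that `(τ − h', τ + h'] = (t, t + h]`), the
Dirichlet polynomial bounded trivially by `4 Σ_{p ≤ e^{2πΔ}} p^{−½} ≪ e^{πΔ}/Δ` (Chebyshev,
`Literature.NumberTheory.LFunctions.sum_primes_inv_sqrt_le`), and the choice
`Δ = (1/π) log(log t/(log log t)²)`, for which
`log t/(2πΔ) + O(e^{πΔ}/Δ) + O(log Δ) + O(1) = (½ + o(1)) log t/log log t`; finally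
`(h/2π)(log(τ/2π) − log(t/2π)) = (h/2π) log(1 + h/2t) ∈ [0, h²/(4πt)] ⊂ [0, 1)`.
(GG take `Δ = (1/π) log(log t/log log t)` and obtain the sharper second-order term of
Balazard–de Roton's Prop. 16; any `Δ` with `πΔ = log log t − o(log log t)` and `e^{πΔ} = o(log t)`
gives the printed `½ + o(1)`.)

## References

* [GoldstonGonek2007] D. A. Goldston, S. M. Gonek, Bull. Lond. Math. Soc. 39 (2007) 482–486,
  Theorem 1 and §2. [cite: GoldstonGonek2007, Thm. 1]
* [BalazardDeRoton2008] M. Balazard, A. de Roton, arXiv:0810.3587, Props. 15–16.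
-/

noncomputable section

open Complex Filter Set MeasureTheory Topology Finset Asymptotics
open scoped Real FourierTransform

namespace Literature.NumberTheory.LFunctions

open Literature.Analysis.Fourier ShortIntervalsRH ShortIntervalsRHLong

namespace GoldstonGonek2007Proof

/-- The Dirichlet polynomial of Prop. 15 (minorant) is trivially `≤ 4 Σ_{p ≤ e^{2πΔ}} p^{-1/2}`.
[cite: BalazardDeRoton2008, Prop. 16 (proof)] -/
theorem abs_primeSum_minorant_le {Δ h t : ℝ} (hΔ : 0 < Δ) (hh : 0 ≤ h) :
    |(1 / π) * ∑ p ∈ (Finset.Ioc 0 ⌊Real.exp (2 * π * Δ)⌋₊).filter Nat.Prime,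
        Real.log p / Real.sqrt p *
          (𝓕 (fun x : ℝ ↦ selbergMinorant Δ (-h) h x) (Real.log p / (2 * π))).re * Real.cos (t * Real.log p)| ≤
      4 * ∑ p ∈ (Finset.Ioc 0 ⌊Real.exp (2 * π * Δ)⌋₊).filter Nat.Prime, (1 / Real.sqrt p : ℝ) := by
  rw [Finset.mul_sum, Finset.mul_sum]
  refine (Finset.abs_sum_le_sum_abs _ _).trans (Finset.sum_le_sum fun p hp ↦ ?_)
  rw [Finset.mem_filter] at hp
  have hp2 : 2 ≤ p := hp.2.two_le
  have hp0 : (0 : ℝ) < p := by exact_mod_cast hp.2.pos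
  have h4 := abs_log_mul_re_fourier_selbergMinorant_le hΔ hh hp2
  have hcos : |Real.cos (t * Real.log p)| ≤ 1 := Real.abs_cos_le_one _
  have hsq : 0 < Real.sqrt p := Real.sqrt_pos.2 hp0
  calc |1 / π * (Real.log p / Real.sqrt p *
          (𝓕 (fun x : ℝ ↦ selbergMinorant Δ (-h) h x) (Real.log p / (2 * π))).re * Real.cos (t * Real.log p))|
      = (1 / Real.sqrt p) * (|Real.log p / π *
          (𝓕 (fun x : ℝ ↦ selbergMinorant Δ (-h) h x) (Real.log p / (2 * π))).re| * |Real.cos (t * Real.log p)|) := by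
        rw [← abs_mul, ← abs_of_pos (by positivity : (0 : ℝ) < 1 / Real.sqrt p), ← abs_mul]
        congr 1; field_simp
    _ ≤ (1 / Real.sqrt p) * (4 * 1) := by gcongr
    _ = 4 * (1 / Real.sqrt p) := by ring

/-- The eventual conditions on `a = log t` used in the proof of Theorem 1 (with `b = log a`,
`c = log b`). [folklore] -/
private theorem eventually_conditions (ε K : ℝ) (hε : 0 < ε) :
    ∀ᶠ a : ℝ in atTop, 4 ≤ a ∧ 1 ≤ Real.log a ∧ 1 ≤ Real.log (Real.log a) ∧
      Real.exp (2 * π) * Real.log a ^ 2 ≤ a ∧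
      4 * Real.log (Real.log a) ≤ Real.log a ∧
      20 * Real.log (Real.log a) ≤ ε * Real.log a ∧
      1200 ≤ ε * Real.log a ∧ K * Real.log a ^ 2 ≤ ε * a ∧ 5 * Real.log a ≤ ε * a ∧ 5 ≤ ε * a := by
  have hlog : Tendsto Real.log atTop atTop := Real.tendsto_log_atTop
  have hloglog : Tendsto (fun a ↦ Real.log (Real.log a)) atTop atTop := hlog.comp hlog
  have h1 : ∀ᶠ a : ℝ in atTop, 4 ≤ a := eventually_ge_atTop 4
  have h2 : ∀ᶠ a : ℝ in atTop, 1 ≤ Real.log a := hlog.eventually_ge_atTop 1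
  have h3 : ∀ᶠ a : ℝ in atTop, 1 ≤ Real.log (Real.log a) := hloglog.eventually_ge_atTop 1
  have h4 : ∀ᶠ a : ℝ in atTop, Real.exp (2 * π) * Real.log a ^ 2 ≤ a := by
    have ho := (Real.isLittleO_pow_log_id_atTop (n := 2)).bound (inv_pos.2 (Real.exp_pos (2 * π)))
    filter_upwards [ho, h1] with a ha ha1
    rw [Real.norm_eq_abs, Real.norm_eq_abs, id, abs_of_pos (by linarith : (0 : ℝ) < a),
      abs_of_nonneg (by positivity)] at ha
    have := mul_le_mul_of_nonneg_left ha (Real.exp_pos (2 * π)).le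
    rwa [← mul_assoc, mul_inv_cancel₀ (Real.exp_pos _).ne', one_mul] at this
  -- `log log a ≤ δ log a` eventually, for any `δ > 0`
  have hll : ∀ δ : ℝ, 0 < δ → ∀ᶠ a : ℝ in atTop, Real.log (Real.log a) ≤ δ * Real.log a := by
    intro δ hδ
    have ho := (Real.isLittleO_log_id_atTop.comp_tendsto hlog).bound hδ
    filter_upwards [ho, h2] with a ha ha2
    simp only [Function.comp, Real.norm_eq_abs, id] at ha
    rw [abs_of_pos (by linarith : 0 < Real.log a)] at ha
    exact (le_abs_self _).trans ha
  have h5 : ∀ᶠ a : ℝ in atTop, 4 * Real.log (Real.log a) ≤ Real.log a := by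
    filter_upwards [hll (1 / 4) (by norm_num)] with a ha
    linarith
  have h6 : ∀ᶠ a : ℝ in atTop, 20 * Real.log (Real.log a) ≤ ε * Real.log a := by
    filter_upwards [hll (ε / 20) (by positivity)] with a ha
    linarith
  have h7 : ∀ᶠ a : ℝ in atTop, 1200 ≤ ε * Real.log a := by
    have := hlog.eventually_ge_atTop (1200 / ε)
    filter_upwards [this] with a ha
    rw [div_le_iff₀ hε] at ha; linarith
  have h8 : ∀ᶠ a : ℝ in atTop, K * Real.log a ^ 2 ≤ ε * a := by
    have ho := (Real.isLittleO_pow_log_id_atTop (n := 2)).bound (by positivity : 0 < ε / (|K| + 1))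
    filter_upwards [ho, h1] with a ha ha1
    rw [Real.norm_eq_abs, Real.norm_eq_abs, id, abs_of_pos (by linarith : (0 : ℝ) < a),
      abs_of_nonneg (by positivity)] at ha
    have hK : K ≤ |K| + 1 := by linarith [le_abs_self K]
    have hpos : 0 ≤ Real.log a ^ 2 := by positivity
    calc K * Real.log a ^ 2 ≤ (|K| + 1) * Real.log a ^ 2 := by gcongr
      _ ≤ (|K| + 1) * (ε / (|K| + 1) * a) := by gcongr
      _ = ε * a := by field_simp
  have h9 : ∀ᶠ a : ℝ in atTop, 5 * Real.log a ≤ ε * a := by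
    have ho := Real.isLittleO_log_id_atTop.bound (by positivity : 0 < ε / 5)
    filter_upwards [ho, h1] with a ha ha1
    rw [Real.norm_eq_abs, Real.norm_eq_abs, id, abs_of_pos (by linarith : (0 : ℝ) < a),
      abs_of_pos (Real.log_pos (by linarith))] at ha
    linarith
  have h10 : ∀ᶠ a : ℝ in atTop, 5 ≤ ε * a := by
    have := tendsto_id.eventually_ge_atTop (5 / ε)
    filter_upwards [this] with a ha
    rw [id, div_le_iff₀ hε] at ha; linarith
  filter_upwards [h1, h2, h3, h4, h5, h6, h7, h8, h9, h10] with a a1 a2 a3 a4 a5 a6 a7 a8 a9 a10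
  exact ⟨a1, a2, a3, a4, a5, a6, a7, a8, a9, a10⟩

/-- `36 ≤ e⁴`. [folklore] -/
private theorem exp_four_ge : (36 : ℝ) ≤ Real.exp 4 := by
  have h1 := Real.exp_one_gt_d9
  have h2 : Real.exp 4 = (Real.exp 1) ^ 4 := by
    rw [← Real.exp_nat_mul]; norm_num
  have h3 : (2.7 : ℝ) ^ 4 ≤ Real.exp 1 ^ 4 := by
    gcongr; linarith
  rw [h2]
  norm_num at h3
  linarith

end GoldstonGonek2007Proof

open GoldstonGonek2007Proof in
/-- **DISCHARGE of `GoldstonGonek2007_thm1`** (Goldston–Gonek 2007, Theorem 1): on RH, for every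
`ε > 0` there is `t₀` such that for `t ≥ t₀` and `0 < h ≤ √t`,
`|N(t+h) − N(t) − (h/2π) log(t/2π)| ≤ (½ + ε) log t/log log t`. Proof as printed, through the
two-sided Prop. 15 of Balazard–de Roton on the full range, applied at the centre `t + h/2` with
half-width `h/2` and `Δ = (1/π) log(log t/(log log t)²)`. RH-CONDITIONAL: RH is the antecedent;
nothing here bears on the truth of RH. [cite: GoldstonGonek2007, Thm. 1] -/
theorem GoldstonGonek2007_thm1_holds : GoldstonGonek2007_thm1 := by
  intro hRH ε hε
  obtain ⟨C₁, hC₁⟩ := zetaZeroCount_short_interval_le_of_RH_long hRH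
  obtain ⟨C₂, hC₂⟩ := zetaZeroCount_short_interval_ge_of_RH_long hRH
  set Cm : ℝ := max |C₁| |C₂| with hCm
  have hCm0 : 0 ≤ Cm := le_max_of_le_left (abs_nonneg C₁)
  have hC1m : C₁ ≤ Cm := (le_abs_self C₁).trans (le_max_left _ _)
  have hC2m : C₂ ≤ Cm := (le_abs_self C₂).trans (le_max_right _ _)
  obtain ⟨a₀, ha₀⟩ := Filter.eventually_atTop.1 (eventually_conditions ε (5 * Cm) hε)
  refine ⟨Real.exp a₀, fun t ht h hh0 hh1 ↦ ?_⟩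
  -- notation: `a = log t`, `b = log log t`, `c = log log log t`, `L = a/b²`, `Δ = (log L)/π`
  have ht0 : 0 < t := (Real.exp_pos a₀).trans_le ht
  set a : ℝ := Real.log t with ha
  have haa₀ : a₀ ≤ a := by rw [ha, ← Real.log_exp a₀]; exact Real.log_le_log (Real.exp_pos _) ht
  obtain ⟨ha4, hb1, hc1, hE4, hE5, hE6, hE7, hE8, hE9, hE10⟩ := ha₀ a haa₀
  have hta : Real.exp a = t := by rw [ha, Real.exp_log ht0]
  have ht36 : 36 ≤ t := by
    rw [← hta]; exact exp_four_ge.trans (Real.exp_le_exp.2 ha4)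
  have haT : a + 1 ≤ t := by rw [← hta]; exact Real.add_one_le_exp a
  set b : ℝ := Real.log a with hb
  set c : ℝ := Real.log b with hc
  have ha0 : 0 < a := by linarith only [ha4]
  have hb0 : 0 < b := by linarith only [hb1]
  have hc0 : 0 < c := by linarith only [hc1]
  have hane : a ≠ 0 := ha0.ne'
  have hbne : b ≠ 0 := hb0.ne'
  set L : ℝ := a / b ^ 2 with hL
  have hL0 : 0 < L := by positivity
  have hLge : Real.exp (2 * π) ≤ L := by rw [hL, le_div_iff₀ (by positivity)]; exact hE4
  have hlogL : Real.log L = b - 2 * c := by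
    rw [hL, Real.log_div ha0.ne' (by positivity), Real.log_pow]; push_cast; ring
  have hlogL2π : 2 * π ≤ Real.log L := by
    rw [← Real.log_exp (2 * π)]; exact Real.log_le_log (Real.exp_pos _) hLge
  set Δ : ℝ := Real.log L / π with hΔ
  have hπ := Real.pi_pos
  have hΔ2 : 2 ≤ Δ := by rw [hΔ, le_div_iff₀ hπ]; linarith only [hlogL2π]
  have hΔ0 : 0 < Δ := by linarith only [hΔ2]
  have hexpπΔ : Real.exp (π * Δ) = L := by
    rw [hΔ, mul_div_cancel₀ _ hπ.ne', Real.exp_log hL0]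
  have hexp2πΔ : Real.exp (2 * π * Δ) = L ^ 2 := by
    rw [show 2 * π * Δ = π * Δ + π * Δ by ring, Real.exp_add, hexpπΔ, sq]
  have hbc : b / 2 ≤ b - 2 * c := by linarith only [hE5]
  have hbc0 : 0 < b - 2 * c := by linarith only [hbc, hb0]
  have hbcne : b - 2 * c ≠ 0 := hbc0.ne'
  have h2πΔ : 2 * π * Δ = 2 * (b - 2 * c) := by rw [hΔ, hlogL]; field_simp
  -- the centre `τ = t + h/2` and the half-width `h/2`
  set τ : ℝ := t + h / 2 with hτ
  have hτt : t ≤ τ := by rw [hτ]; linarith only [hh0]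
  have hτ36 : 36 ≤ τ := ht36.trans hτt
  have hτ0 : 0 < τ := by linarith only [ht0, hτt]
  have hsqrt_t : Real.sqrt t ≤ t := by
    rw [Real.sqrt_le_left ht0.le]; nlinarith only [ht36]
  have hh't : h / 2 ≤ Real.sqrt τ := by
    have : Real.sqrt t ≤ Real.sqrt τ := Real.sqrt_le_sqrt hτt
    linarith only [hh1, this, hh0]
  have hh'0 : 0 < h / 2 := by linarith only [hh0]
  have hLτ : Real.exp (π * Δ) ≤ τ := by
    rw [hexpπΔ]
    have hLa : L ≤ a := by
      rw [hL, div_le_iff₀ (by positivity)]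
      have hb2 : (1 : ℝ) ≤ b ^ 2 := one_le_pow₀ hb1
      exact le_mul_of_one_le_right ha0.le hb2
    linarith only [hLa, haT, hτt]
  -- `log τ ≤ a + 1`
  have hlogτ : Real.log τ ≤ a + 1 := by
    have h2t : τ ≤ 2 * t := by rw [hτ]; linarith only [hh1, hsqrt_t, hh0]
    calc Real.log τ ≤ Real.log (2 * t) := Real.log_le_log hτ0 h2t
      _ = Real.log 2 + a := by rw [Real.log_mul (by norm_num) ht0.ne']
      _ ≤ a + 1 := by linarith only [Real.log_two_lt_d9]
  -- the shift of the main term: `0 ≤ (h/2π)(log(τ/2π) − log(t/2π)) ≤ 1`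
  have hshift_eq : Real.log (τ / (2 * π)) - Real.log (t / (2 * π)) = Real.log (τ / t) := by
    rw [← Real.log_div (by positivity) (by positivity)]
    congr 1; field_simp
  have hshift0 : 0 ≤ h / (2 * π) * (Real.log (τ / (2 * π)) - Real.log (t / (2 * π))) := by
    rw [hshift_eq]
    exact mul_nonneg (by positivity) (Real.log_nonneg (by rw [le_div_iff₀ ht0]; linarith only [hτt]))
  have hshift1 : h / (2 * π) * (Real.log (τ / (2 * π)) - Real.log (t / (2 * π))) ≤ 1 := by
    rw [hshift_eq]
    have hlog : Real.log (τ / t) ≤ h / (2 * t) := by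
      have := Real.log_le_sub_one_of_pos (by positivity : 0 < τ / t)
      have hq : τ / t - 1 = h / (2 * t) := by rw [hτ]; field_simp; ring
      linarith only [this, hq]
    have hh2 : h ^ 2 ≤ t := by
      have h1 : h ^ 2 ≤ Real.sqrt t ^ 2 := by gcongr
      rwa [Real.sq_sqrt ht0.le] at h1
    calc h / (2 * π) * Real.log (τ / t) ≤ h / (2 * π) * (h / (2 * t)) := by gcongr
      _ = h ^ 2 / t * (1 / (4 * π)) := by ring
      _ ≤ 1 * (1 / (4 * π)) := by gcongr; rwa [div_le_one ht0]
      _ ≤ 1 := by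
          rw [one_mul, div_le_one (by positivity)]; linarith only [Real.pi_gt_three]
  -- Chebyshev for the Dirichlet polynomial: `4 Σ_{p ≤ L²} p^{-1/2} ≤ 240 a / b²`
  have hX2 : (2 : ℝ) ≤ L ^ 2 := by
    have : Real.exp (2 * π) ≥ 2 := by
      linarith [Real.add_one_le_exp (2 * π), Real.pi_gt_three]
    nlinarith only [this, hLge]
  have hsqL : Real.sqrt (L ^ 2) = L := Real.sqrt_sq hL0.le
  have hlogL2 : Real.log (L ^ 2) = 2 * (b - 2 * c) := by rw [Real.log_pow, hlogL]; push_cast; ring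
  have hcheb := sum_primes_inv_sqrt_le hX2
  rw [hsqL, hlogL2] at hcheb
  have hpoly : 4 * ∑ p ∈ (Finset.Ioc 0 ⌊L ^ 2⌋₊).filter Nat.Prime, (1 / Real.sqrt p : ℝ) ≤ 240 * a / b ^ 2 := by
    have hLle : L ≤ a / b := by
      rw [hL, div_le_div_iff₀ (by positivity) hb0]
      have hbb : b ≤ b ^ 2 := by nlinarith only [hb1]
      have := mul_le_mul_of_nonneg_left hbb ha0.le
      linarith only [this]
    calc 4 * ∑ p ∈ (Finset.Ioc 0 ⌊L ^ 2⌋₊).filter Nat.Prime, (1 / Real.sqrt p : ℝ)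
        ≤ 4 * (60 * L / (2 * (b - 2 * c))) := by gcongr
      _ = 120 * L / (b - 2 * c) := by field_simp; ring
      _ ≤ 120 * (a / b) / (b / 2) := by gcongr
      _ = 240 * a / b ^ 2 := by field_simp; ring
  -- the `C log Δ` terms: `0 ≤ log Δ ≤ log b = c`
  have hlogΔ0 : 0 ≤ Real.log Δ := Real.log_nonneg (by linarith only [hΔ2])
  have hlogΔc : Real.log Δ ≤ c := by
    have hΔle : Δ ≤ b := by
      rw [hΔ, div_le_iff₀ hπ, hlogL]
      nlinarith only [Real.pi_gt_three, hb0, hc0]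
    rw [hc]; exact Real.log_le_log hΔ0 hΔle
  have hClog1 : C₁ * Real.log Δ ≤ Cm * c := by
    calc C₁ * Real.log Δ ≤ Cm * Real.log Δ := by gcongr
      _ ≤ Cm * c := by gcongr
  have hClog2 : C₂ * Real.log Δ ≤ Cm * c := by
    calc C₂ * Real.log Δ ≤ Cm * Real.log Δ := by gcongr
      _ ≤ Cm * c := by gcongr
  -- the main term `(a + 1)/(2(b − 2c)) ≤ a/(2b) + 1/(2b)·2 + 4ac/b²`  (using `b − 2c ≥ b/2`)
  have hmain_t : Real.log τ / (2 * π * Δ) ≤ (a + 1) / (2 * (b - 2 * c)) := by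
    rw [h2πΔ]
    exact div_le_div_of_nonneg_right hlogτ (by positivity)
  have hmain_le : (a + 1) / (2 * (b - 2 * c)) ≤ a / (2 * b) + 1 / b + 4 * a * c / b ^ 2 := by
    -- `1/(b − 2c) = 1/b + 2c/(b(b − 2c)) ≤ 1/b + 4c/b²`
    have hinv : 1 / (b - 2 * c) ≤ 1 / b + 4 * c / b ^ 2 := by
      have hid : 1 / (b - 2 * c) - 1 / b = 2 * c / (b * (b - 2 * c)) := by
        field_simp; ring
      have hle : 2 * c / (b * (b - 2 * c)) ≤ 4 * c / b ^ 2 := by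
        rw [div_le_div_iff₀ (by positivity) (by positivity)]
        have h1 : 2 * b ≤ 4 * (b - 2 * c) := by linarith only [hbc]
        calc 2 * c * b ^ 2 = c * b * (2 * b) := by ring
          _ ≤ c * b * (4 * (b - 2 * c)) := mul_le_mul_of_nonneg_left h1 (by positivity)
          _ = 4 * c * (b * (b - 2 * c)) := by ring
      linarith only [hid, hle]
    have h1 : (a + 1) / (2 * (b - 2 * c)) = (a + 1) / 2 * (1 / (b - 2 * c)) := by
      field_simp
    have h2 : (a + 1) / 2 * (1 / b + 4 * c / b ^ 2) = a / (2 * b) + 1 / (2 * b) + 2 * (a + 1) * c / b ^ 2 := by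
      field_simp; ring
    have h3 : (a + 1) / 2 * (1 / (b - 2 * c)) ≤ (a + 1) / 2 * (1 / b + 4 * c / b ^ 2) :=
      mul_le_mul_of_nonneg_left hinv (by positivity)
    have h4 : 1 / (2 * b) ≤ 1 / b := by
      rw [div_le_div_iff₀ (by positivity) hb0]; linarith only [hb0]
    have h5 : 2 * (a + 1) * c / b ^ 2 ≤ 4 * a * c / b ^ 2 := by
      rw [div_le_div_iff_of_pos_right (by positivity)]; nlinarith only [ha4, hc0]
    linarith only [h1, h2, h3, h4, h5]
  -- the five small terms are each `≤ (ε/5) a/b`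
  have hab0 : 0 < a / b := by positivity
  have hs1 : 1 / b ≤ (ε / 5) * (a / b) := by
    rw [show (ε / 5) * (a / b) = (ε * a / 5) / b by ring, div_le_div_iff_of_pos_right hb0]
    linarith only [hE10]
  have hs2 : 4 * a * c / b ^ 2 ≤ (ε / 5) * (a / b) := by
    rw [show (ε / 5) * (a / b) = (ε * b / 5) * a / b ^ 2 by field_simp,
      div_le_div_iff_of_pos_right (by positivity)]
    have : 4 * c ≤ ε * b / 5 := by rw [hc]; linarith only [hE6]
    nlinarith only [this, ha0]
  have hs3 : 240 * a / b ^ 2 ≤ (ε / 5) * (a / b) := by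
    rw [show (ε / 5) * (a / b) = (ε * b / 5) * a / b ^ 2 by field_simp,
      div_le_div_iff_of_pos_right (by positivity)]
    have : (240 : ℝ) ≤ ε * b / 5 := by linarith only [hE7]
    nlinarith only [this, ha0]
  have hs4 : Cm * c ≤ (ε / 5) * (a / b) := by
    -- `5 Cm b c ≤ 5 Cm b² ≤ ε a`
    have hcb : c ≤ b := by
      rw [hc]
      have := Real.log_le_sub_one_of_pos hb0
      linarith only [this]
    rw [show (ε / 5) * (a / b) = (ε * a / 5) / b by ring, le_div_iff₀ hb0]
    calc Cm * c * b ≤ Cm * b * b := by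
          have := mul_le_mul_of_nonneg_left hcb hCm0
          nlinarith only [this, hb0]
      _ = (5 * Cm * b ^ 2) / 5 := by ring
      _ ≤ (ε * a) / 5 := by gcongr
      _ = ε * a / 5 := by ring
  have hs5 : (1 : ℝ) ≤ (ε / 5) * (a / b) := by
    rw [show (ε / 5) * (a / b) = (ε * a / 5) / b by ring, le_div_iff₀ hb0]
    linarith only [hE9]
  -- Prop. 15, upper and lower, at the centre `τ` with half-width `h/2`
  have h15u := hC₁ τ Δ (h / 2) hτ36 hΔ2 hLτ hh'0 hh't
  have h15l := hC₂ τ Δ (h / 2) hτ36 hΔ2 hLτ hh'0 hh't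
  have hprime_u := ShortIntervalsGG.abs_primeSum_le (t := τ) (h := h / 2) hΔ0 hh'0.le
  have hprime_l := abs_primeSum_minorant_le (t := τ) (h := h / 2) hΔ0 hh'0.le
  rw [hexp2πΔ] at hprime_u hprime_l h15u h15l
  have e1 : τ + h / 2 = t + h := by rw [hτ]; ring
  have e2 : τ - h / 2 = t := by rw [hτ]; ring
  have e3 : 2 * (h / 2) * Real.log (τ / (2 * π)) / (2 * π) = h / (2 * π) * Real.log (τ / (2 * π)) := by
    ring
  rw [e1, e2, e3] at h15u h15l
  have habs_u := (abs_le.1 hprime_u).1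
  have habs_l := (abs_le.1 hprime_l).2
  -- the target, in the notation `a`, `b`
  have hgoal : (1 / 2 + ε) * a / b = a / (2 * b) + 5 * ((ε / 5) * (a / b)) := by
    field_simp
  rw [hgoal, abs_le]
  constructor
  · -- lower bound
    have hsum : (a + 1) / (2 * (b - 2 * c)) + 240 * a / b ^ 2 + Cm * c ≤
        a / (2 * b) + 5 * ((ε / 5) * (a / b)) := by
      linarith only [hmain_le, hs1, hs2, hs3, hs4, hs5]
    linarith only [h15l, habs_l, hpoly, hClog2, hmain_t, hsum, hshift0]
  · -- upper bound
    have hsum : (a + 1) / (2 * (b - 2 * c)) + 240 * a / b ^ 2 + Cm * c + 1 ≤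
        a / (2 * b) + 5 * ((ε / 5) * (a / b)) := by
      linarith only [hmain_le, hs1, hs2, hs3, hs4, hs5]
    linarith only [h15u, habs_u, hpoly, hClog1, hmain_t, hsum, hshift1]

end Literature.NumberTheory.LFunctions
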